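import Mathlib.Analysis.SpecialFunctions.Exponential
import Mathlib.MeasureTheory.Integral.IntervalIntegral.FundThmCalculus
import Mathlib.Analysis.SpecialFunctions.Pow.Real
import Literature.MathematicalPhysics.QuantumLattice.LieTrotter
import HarnessLib

/-!
# Dimock, *Ultraviolet stability for QED in d = 3*, §4.2.3 «fermion integral — small field region», LEMMA 26 (503)
# «`Ξ_K(A_K)∕Z_f(N,0) = 1 + O(e_K^{1∕4−8ε})`»: its CLOSING STEP (511)–(514) — the Duhamel formula
# `∫e^{E}dμ_I − 1 = ∫₀¹dt∫E e^{tE}dμ_I`, the bound `sup_t‖E e^{tE}‖₁ ≤ ‖E‖₁e^{‖E‖₁}` and the smallness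
# «`O(1)e_K^{1∕4−7ε}|T⁰_{N−K}| ≤ e_K^{1∕4−8ε}`», PROVED in any complete normed algebra with `‖1‖ = 1`

statement-level skeleton of published theorems with citation tags; proofs where landed; nothing here is a claim about the Yang–Mills mass gap

**Citation header (reproduction of PUBLISHED work).** J. Dimock, *Ultraviolet stability for QED in d = 3*, Ann. Henri
Poincaré **23** (2022) 2113–2205 (= arXiv:2009.01156v2) [Dimock2022UVStabilityQED3], §4.2.3 LEMMA 26 (503) p.69 L1–3
with its proof (504)–(514) p.69 L4 – p.70 L27, and the appendix bound «`|∫f(Ψ)dμ_I(Ψ)| ≤ ‖f‖₁`» quoted p.61 L57, of the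
held arXiv text layer `paper:arxiv-2009.01156` (`p.NN Lnn` = PDF page ∕ text-layer line).  Writer seat p11
(literature-prover-lit-balaban-p11-g25-0), YM LIT SWEEP item (c) D8 (row C08; zero weight for the YM-INPRINT tokens —
LEMMA 26 is the second factor of (519) in LEMMA 27, cf. `QED3StabilityBoundAssembly`).  Mathlib + the tree's
`QuantumLattice.LieTrotter` (for `‖e^{Y}‖ ≤ e^{‖Y‖}` in a Banach algebra).

**The printed text (verbatim, text layer).**  p.69 L1–3: *"Lemma 26. For `|dA_K| ≤ p_K` and uniformly in `N`
`Ξ_K(A_K)∕Z_f(N,0) = 1 + O(e_K^{1∕4−8ε})` (503)"*.  p.69 L20–22: *"… we identify a Gaussian integral with covariance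
`C_K(0) = D_K(0)⁻¹` introduced in lemma 22. Then we have `Ξ_K(A)∕Z_f(N,0) = ∫e^{E*_K(Λ_K)}dμ_{C_K(0)}(Ψ_K)` (506)"*.
p.69 L112 – p.70 L27: *"Now we write
`Ξ_K(A)∕Z_f(N,0) = 1 + ∫(exp(E*_K(Λ_K)) − 1)dμ_{C_K(0)}(Ψ_K) = 1 + ∫₀¹dt∫E*_K(Λ_K)e^{tE*_K(Λ_K)}dμ_{C_K(0)}(Ψ_K)
= 1 + ∫₀¹dt∫E**_K(Λ_K)e^{tE**_K(Λ_K)}dμ_I(Ψ_K)` (511) Here in the last step we changed to an identity covariance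
defining `E**_K(Λ_K, A, Ψ̄_K, Ψ_K) = E*_K(Λ_K, A, Ψ̄_K, C_K(0)Ψ_K)` (512) As noted in lemma 22 `C_K(0)` has a bounded
kernel … It follows that `‖E**_K(Λ_K)‖₁ ≤ ‖E*_K(Λ_K)‖_{C(Mr_K)⁶} ≤ ‖E*_K(Λ_K)‖_{C₀⁻¹h_K} ≤ O(1)e_K^{1∕4−7ε}|T⁰_{N−K}|`
(513) This is small since `|T⁰_{N−K}| = (Mr_K)³` is only logarithmic in `e_K`. Then
`sup_{0≤t≤1}‖E**_K(Λ_K)exp(tE**_K(Λ_K))‖₁ ≤ ‖E**_K(Λ_K)‖₁exp(‖E**_K(Λ_K)‖₁) ≤ O(1)e_K^{1∕4−7ε}|T⁰_{N−K}|` (514) This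
implies `|Ξ_K(A)∕Z_f(N,0) − 1|` is bounded by `O(1)e_K^{1∕4−7ε}|T⁰_{N−K}| ≤ e_K^{1∕4−8ε}` and hence the result."*
p.61 L57: *"In general on a unit lattice `|∫f(Ψ)dμ_I(Ψ)| ≤ ‖f‖₁`, see the appendix in [30]."*

**What is formalized (kernel-checked, zero `sorry`, no named facts).**  The mechanism of (511)–(514), for an element
`E` of ANY complete normed `ℝ`-algebra `𝔸` with `‖1‖ = 1` (the finite-dimensional Grassmann algebra generated by
`Ψ̄_K, Ψ_K` with the norm `‖·‖₁` of Appendix B is one: `‖FG‖₁ ≤ ‖F‖₁‖G‖₁`, `‖1‖₁ = 1`) and ANY additive functional `ι`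
on `𝔸` with `|ι F| ≤ ‖F‖` and `ι 1 = 1` (the Berezin integral `∫ · dμ_I`, by the quoted appendix bound and
`∫dμ_I = 1`):
* §1 — **`exp_sub_one_eq_integral`** = the Duhamel formula of (511) `e^E − 1 = ∫₀¹ E e^{tE}dt` (fundamental
  theorem of calculus in `𝔸`); **`norm_mul_exp_smul_le`** = (514) `‖E e^{tE}‖ ≤ ‖E‖e^{‖E‖}` (`0 ≤ t ≤ 1`; the
  ingredient `‖e^{Y}‖ ≤ e^{‖Y‖}` is the tree's `QuantumLattice.norm_exp_le`, imported); `norm_integral_mul_exp_smul_le`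
  (the Duhamel integral is bounded by `‖E‖e^{‖E‖}`).  (The resulting `‖e^E − 1‖ ≤ ‖E‖e^{‖E‖}` is already in the tree
  for `ℂ`-algebras as `BalabanJaffe1986.BJ86PathOrdered18.norm_exp_sub_one_le`, by the series route; not restated.)
* §2 — **`norm_functional_exp_sub_one_le`**: `|ι(e^E) − 1| ≤ ‖E‖e^{‖E‖}` («This implies `|Ξ_K(A)∕Z_f(N,0) − 1|` is
  bounded by …») via (511) + (514), with the first equality of (511) `ι(e^E) − 1 = ι(e^E − 1)`
  (`functional_exp_sub_one`).
* §3 — the printed smallness: `smallness_513_514` (`‖E‖ ≤ c·e_K^{a}·T`, `c·e_K^{a}·T ≤ 1` and `e·c·T·e_K^{ε} ≤ 1` —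
  «`|T⁰_{N−K}|` is only logarithmic in `e_K`» — give `‖E‖e^{‖E‖} ≤ e_K^{a−ε}`) and **`lemma26_closing`** = (503) from
  (513): `|ι(e^{E}) − 1| ≤ e_K^{1∕4−8ε}`.

**Readings (declared).**  (i) `O(1)` in (513)–(514) is an explicit constant `c ≥ 0`; the two «sufficiently small»
uses are the explicit hypotheses `c·e_K^{1∕4−7ε}·|T⁰| ≤ 1` and `e·c·|T⁰|·e_K^{ε} ≤ 1`.  (ii) The inputs (504)–(510)
(the definition of `E*_K`, the contour representation (508), the bounds (507), (509)–(510)) and (512)–(513) (the change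
to identity covariance and the weighted-norm comparison) are NOT reproduced: the file starts from an element `E`
(= `E**_K(Λ_K)`) with the bound (513) as hypothesis.  (iii) The printed `sup_t` in (514) is the pointwise bound for
every `t ∈ [0,1]`, which is what the Duhamel integral consumes.

**Honest scope.**  Banach-algebra calculus and the final arithmetic only; no Grassmann algebra is constructed here and
nothing is said about `E_K`, `H#_K`, `C_K(0)` beyond the hypotheses named.  No `d = 4` statement; nothing about
Bałaban's papers.
-/

noncomputable section

namespace Literature.MathematicalPhysics.QuantumFieldTheory.Dimock2011to13

namespace QED3SmallFieldFermion

open NormedSpace MeasureTheory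

variable {𝔸 : Type*} [NormedRing 𝔸] [NormedAlgebra ℝ 𝔸] [CompleteSpace 𝔸]

/-! ## §1 The exponential in a complete normed algebra: (511) Duhamel and (514) -/

/-- **(511), the Duhamel formula** behind «`∫(exp(E) − 1)dμ = ∫₀¹dt∫E e^{tE}dμ`»: in a complete normed `ℝ`-algebra,
`e^E − 1 = ∫₀¹ E e^{tE}dt` (Bochner integral; `t ↦ e^{tE}` has derivative `E e^{tE}`).
[cite: Dimock2022UVStabilityQED3, §4.2.3 Lemma 26 proof (511) p.69 L112–137] -/
theorem exp_sub_one_eq_integral (x : 𝔸) : exp x - 1 = ∫ t in (0 : ℝ)..1, x * exp (t • x) := by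
  have hderiv : ∀ t ∈ Set.uIcc (0 : ℝ) 1, HasDerivAt (fun u : ℝ => exp (u • x)) (x * exp (t • x)) t :=
    fun t _ => hasDerivAt_exp_smul_const' (𝕂 := ℝ) x t
  have hcont0 : Continuous fun t : ℝ => exp (t • x) :=
    continuous_iff_continuousAt.mpr fun t => (hasDerivAt_exp_smul_const' (𝕂 := ℝ) x t).continuousAt
  have hcont : Continuous fun t : ℝ => x * exp (t • x) := continuous_const.mul hcont0
  rw [intervalIntegral.integral_eq_sub_of_hasDerivAt hderiv (hcont.intervalIntegrable _ _)]
  simp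

variable [NormOneClass 𝔸]

/-- **(514)**: «`sup_{0≤t≤1}‖E exp(tE)‖₁ ≤ ‖E‖₁exp(‖E‖₁)`» — for every `t ∈ [0,1]`, `‖E e^{tE}‖ ≤ ‖E‖e^{‖E‖}`.
[cite: Dimock2022UVStabilityQED3, §4.2.3 Lemma 26 proof (514) p.70 L18–31] -/
theorem norm_mul_exp_smul_le (x : 𝔸) {t : ℝ} (ht0 : 0 ≤ t) (ht1 : t ≤ 1) :
    ‖x * exp (t • x)‖ ≤ ‖x‖ * Real.exp ‖x‖ := by
  calc ‖x * exp (t • x)‖ ≤ ‖x‖ * ‖exp (t • x)‖ := norm_mul_le _ _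
    _ ≤ ‖x‖ * Real.exp ‖t • x‖ :=
        mul_le_mul_of_nonneg_left (QuantumLattice.norm_exp_le ℝ _) (norm_nonneg _)
    _ ≤ ‖x‖ * Real.exp ‖x‖ := by
        refine mul_le_mul_of_nonneg_left (Real.exp_le_exp.mpr ?_) (norm_nonneg _)
        rw [norm_smul, Real.norm_of_nonneg ht0]
        calc t * ‖x‖ ≤ 1 * ‖x‖ := mul_le_mul_of_nonneg_right ht1 (norm_nonneg _)
          _ = ‖x‖ := one_mul _

/-- (514) integrated over the Duhamel parameter: `‖∫₀¹ E e^{tE}dt‖ ≤ ‖E‖e^{‖E‖}` (interval of length `1`).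
[cite: Dimock2022UVStabilityQED3, §4.2.3 Lemma 26 proof (511), (514) p.69 L112 – p.70 L31] -/
theorem norm_integral_mul_exp_smul_le (x : 𝔸) :
    ‖∫ t in (0 : ℝ)..1, x * exp (t • x)‖ ≤ ‖x‖ * Real.exp ‖x‖ := by
  have h := intervalIntegral.norm_integral_le_of_norm_le_const (a := (0 : ℝ)) (b := 1)
    (f := fun t : ℝ => x * exp (t • x)) (C := ‖x‖ * Real.exp ‖x‖) (fun t ht => by
      rw [Set.uIoc_of_le zero_le_one] at ht
      exact norm_mul_exp_smul_le x ht.1.le ht.2)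
  simpa using h

/-! ## §2 The integral: «This implies `|Ξ_K(A)∕Z_f(N,0) − 1|` is bounded by …» -/

omit [NormedAlgebra ℝ 𝔸] [CompleteSpace 𝔸] [NormOneClass 𝔸] in
/-- the first equality of (511): for an additive functional with `ι 1 = 1` (`∫dμ = 1`),
`ι(e^E) − 1 = ι(e^E − 1)` — «`∫e^{E}dμ = 1 + ∫(exp(E) − 1)dμ`».
[cite: Dimock2022UVStabilityQED3, §4.2.3 Lemma 26 proof (506), (511) p.69 L20–22, L112–120] -/
theorem functional_exp_sub_one {K : Type*} [Ring K] (ι : 𝔸 →+ K) (hι1 : ι 1 = 1) (x : 𝔸) :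
    ι (exp x) - 1 = ι (exp x - 1) := by
  rw [map_sub, hι1]

/-- **(511)–(514) ⟹ «`|Ξ_K(A)∕Z_f(N,0) − 1|` is bounded by `‖E**‖₁e^{‖E**‖₁}`»**: for an additive functional `ι` on a
complete normed algebra (`‖1‖ = 1`) with `|ι F| ≤ ‖F‖` («`|∫f dμ_I| ≤ ‖f‖₁`», p.61 L57) and `ι 1 = 1`:
`|ι(e^E) − 1| ≤ ‖E‖e^{‖E‖}`.
[cite: Dimock2022UVStabilityQED3, §4.2.3 Lemma 26 proof (511)–(514) p.69 L112 – p.70 L33; p.61 L57] -/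
theorem norm_functional_exp_sub_one_le {K : Type*} [NormedRing K] (ι : 𝔸 →+ K)
    (hι : ∀ F : 𝔸, ‖ι F‖ ≤ ‖F‖) (hι1 : ι 1 = 1) (x : 𝔸) :
    ‖ι (exp x) - 1‖ ≤ ‖x‖ * Real.exp ‖x‖ := by
  rw [functional_exp_sub_one ι hι1, exp_sub_one_eq_integral]
  exact (hι _).trans (norm_integral_mul_exp_smul_le x)

/-! ## §3 The smallness: (513)–(514) ⟹ (503) -/

omit [NormedAlgebra ℝ 𝔸] [CompleteSpace 𝔸] [NormOneClass 𝔸] in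
/-- **(513)–(514), the arithmetic**: if `‖E‖ ≤ c·e_K^{a}·T` ((513), `T = |T⁰_{N−K}|`, `c = O(1) ≥ 0`), the product
`c·e_K^{a}·T ≤ 1`, and «`|T⁰_{N−K}| = (Mr_K)³` is only logarithmic in `e_K`» in the explicit form `e·c·T·e_K^{ε} ≤ 1`,
then `‖E‖e^{‖E‖} ≤ e_K^{a−ε}`. [cite: Dimock2022UVStabilityQED3, §4.2.3 Lemma 26 proof (513)–(514) p.70 L5–33] -/
theorem smallness_513_514 {E : 𝔸} {c T eK a ε : ℝ} (heK : 0 < eK) (hc : 0 ≤ c) (hT : 0 ≤ T)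
    (h513 : ‖E‖ ≤ c * eK ^ a * T) (hprod : c * eK ^ a * T ≤ 1) (hlog : Real.exp 1 * c * T * eK ^ ε ≤ 1) :
    ‖E‖ * Real.exp ‖E‖ ≤ eK ^ (a - ε) := by
  have hsplit : eK ^ a = eK ^ ε * eK ^ (a - ε) := by
    rw [← Real.rpow_add heK]; congr 1; ring
  have hpow : 0 ≤ eK ^ (a - ε) := (Real.rpow_pos_of_pos heK _).le
  have h1 : Real.exp ‖E‖ ≤ Real.exp 1 := Real.exp_le_exp.mpr (h513.trans hprod)
  calc ‖E‖ * Real.exp ‖E‖ ≤ (c * eK ^ a * T) * Real.exp 1 :=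
        mul_le_mul h513 h1 (Real.exp_pos _).le (by positivity)
    _ = (Real.exp 1 * c * T * eK ^ ε) * eK ^ (a - ε) := by rw [hsplit]; ring
    _ ≤ 1 * eK ^ (a - ε) := mul_le_mul_of_nonneg_right hlog hpow
    _ = eK ^ (a - ε) := one_mul _

/-- **LEMMA 26 (503) from (511)–(514)** — «This implies `|Ξ_K(A)∕Z_f(N,0) − 1|` is bounded by
`O(1)e_K^{1∕4−7ε}|T⁰_{N−K}| ≤ e_K^{1∕4−8ε}` and hence the result»: with `Ξ_K(A)∕Z_f(N,0) = ι(e^{E})` ((506), (511)–(512):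
`E = E**_K(Λ_K)`, `ι = ∫ · dμ_I`, `|ι F| ≤ ‖F‖₁`, `ι 1 = 1`), the bound (513) `‖E‖₁ ≤ c·e_K^{1∕4−7ε}·|T⁰_{N−K}|` and the
two explicit smallness conditions of `smallness_513_514`: `|Ξ_K(A)∕Z_f(N,0) − 1| ≤ e_K^{1∕4−8ε}`.
[cite: Dimock2022UVStabilityQED3, §4.2.3 Lemma 26 (503) p.69 L1–3; proof (511)–(514) p.69 L112 – p.70 L33] -/
theorem lemma26_closing {K : Type*} [NormedRing K] (ι : 𝔸 →+ K) (hι : ∀ F : 𝔸, ‖ι F‖ ≤ ‖F‖)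
    (hι1 : ι 1 = 1) {E : 𝔸} {c T eK ε : ℝ} (heK : 0 < eK) (hc : 0 ≤ c) (hT : 0 ≤ T)
    (h513 : ‖E‖ ≤ c * eK ^ (1 / 4 - 7 * ε) * T) (hprod : c * eK ^ (1 / 4 - 7 * ε) * T ≤ 1)
    (hlog : Real.exp 1 * c * T * eK ^ ε ≤ 1) :
    ‖ι (exp E) - 1‖ ≤ eK ^ (1 / 4 - 8 * ε) := by
  have h := smallness_513_514 heK hc hT h513 hprod hlog
  rw [show (1 : ℝ) / 4 - 7 * ε - ε = 1 / 4 - 8 * ε by ring] at h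
  exact (norm_functional_exp_sub_one_le ι hι hι1 E).trans h

end QED3SmallFieldFermion

end Literature.MathematicalPhysics.QuantumFieldTheory.Dimock2011to13
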